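import Literature.AlgebraicGeometry.ModuliOfAbelianVarieties.SiegelFineModuliArtinianLifting
import Literature.AlgebraicGeometry.AbelianSchemes.PolarizationLevelBaseQuotientDescent
import Literature.AlgebraicGeometry.AbelianSchemes.PoincareNormalizeBaseChange
import Literature.AlgebraicGeometry.AbelianSchemes.PolarizationNormalize
import Literature.AlgebraicGeometry.AbelianSchemes.AbelianSchemeOverMulNEtale
import Literature.AlgebraicGeometry.AbelianSchemes.AbelianSchemeOverZariskiGluingLevel
import HarnessLib

/-!
# F-11 road A, row (A2): along a nilpotent thickening of the base, a lift of the POLARISED ABELIAN SCHEME is a lift of the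
# whole moduli triple — level structure, type, symplectic liftability and the second normalisation come for free
# ([MumfordFogartyKirwan1994] Ch. 7 §2 Def. 7.2 / §3; [SGA1] I Cor. 5.6; [Lan2013PELCompactifications] §2.2.1)

Layer `Literature/AlgebraicGeometry/ModuliOfAbelianVarieties` (+ two generic lemmas in
`Literature.AlgebraicGeometry.AbelianSchemes`).  THEOREMS ONLY (no definition, no named fact, no instance, no notation, no
`sorry`).  Cell `hodgecm-mathlib` (D-0151), F-DAG leaf **F-11 «`𝒜_{g,δ,N} → Spec ℚ` is smooth»**, ROAD A (Artinian lifting)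
of the census `B-provers/B-p13/g20/CENSUS-F11-Smoothness.B-p13g20.md` §3, row **(A2) LEVEL + CLAUSES**, re-based on the
repaired carrier (edition 2 of ★ `PolarizedAbelianSchemeWithLevel`: every triple carries `hatNormalised`).  Seat B-p05 (g19).
HC_CM is proved only modulo the 7 printed citations until rung 0 closes; this file discharges none of them (count-neutral
capital toward `stub_F11`).

THE PRINT.  [MumfordFogartyKirwan1994] Ch. 7 §2 Prop. 7.6 / §3 Thm. 7.9 and [Lan2013PELCompactifications] §2.2.1
(p. 130): the infinitesimal lifting problem for the moduli functor `𝒜_{g,δ,N}` along a small extension `A ↠ A ⧸ J` of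
Artinian local rings is the lifting problem for the POLARISED ABELIAN SCHEME `(X₀, λ₀)` alone — «the level structure
extends uniquely since `X[N]` is étale» ([SGA1] Exp. I Cor. 5.6 applied to `[N] : X → X`; [Lan2013PELCompactifications]
§2.2.1, proof of Prop. 2.2.4.?: «level structures … are rigid»), and the discrete invariants (the type `δ` of `λ`,
[MumfordFogartyKirwan1994] App. 7A, and the symplectic-liftability of the level structure, [Lan2013PELCompactifications]
Lemma 1.3.6.6 «it suffices to verify the statements over each geometric point») are read on geometric points, which do not
see the thickening.  In the tree's carrier the triple has one more field, the second normalisation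
`hatNormalised : (1_X × ε_X̂)^*𝒫 ≅ 𝒪` of the Poincaré sheaf ([MumfordFogartyKirwan1994] Ch. 6 §2 p. 121), which is NOT
automatic over a non-reduced base: the lift is RENORMALISED (★ `DualPair.normalize`, ★ `PolarizationNormalize`), the
Poincaré clause of the pull-back relation surviving by ★ `PoincareNormalizeBaseChange` because the given triple over
`A ⧸ J` is itself normalised.

WHAT IS HERE.
* §1 `AbelianSchemeOver.LevelStructure.exists_isBaseChangeVia_of_surjective` — level-`N` structures lift along a
  base-change square `(G, i)` over a SURJECTIVE CLOSED IMMERSION `i : S₀ → S` when `[N]_X` is étale, in the RELATION form ★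
  `LevelStructure.IsBaseChangeVia` (★ `existsUnique_section_pow_eq_one_of_isBaseChangeVia` for the sections; the basis
  clauses at geometric points through ★ `IsBaseChangeVia.pushHomMulEquiv`).  (★ `LevelStructure.existsUnique_baseChange_eq` is
  the case of the CHOSEN base change `X ×_S S₀`.)
* §2 `PolarizedAbelianSchemeWithLevel.exists_isBaseChangeVia_of_polarizedLift` — THE ROW: for a triple `P₀` over `S₀`, a
  surjective closed immersion `i : S₀ → S`, and level-free lift data over `S` in relation form — an abelian scheme `X/S` of
  relative dimension `g` with `[N]_X` étale, a dual pair `D`, a polarisation `pol`, and `G : X₀ → X`, `Ĝ : X̂₀ → X̂` over `i`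
  with the four level-free clauses of ★ `PolarizedAbelianSchemeWithLevel.IsBaseChangeVia` (group-scheme squares for `X` and
  `X̂`, Poincaré `(G × Ĝ)^*𝒫 ≅ 𝒫₀`, `λ₀ ≫ Ĝ = G ≫ λ`) — there is a TRIPLE `P` over `S` (underlying `(X, D.normalize, λ)`) with
  `P₀.IsBaseChangeVia P i G Ĝ`.  Type and symplectic liftability by the relation-form transfers ★
  `Polarization.hasType_of_isBaseChangeVia` / ★ `LevelStructure.isSymplecticLiftable_of_isBaseChangeVia` (geometric points of
  `S` factor through `i`), then ★ `PolarizationNormalize` (same `λ`); `hatNormalised` by ★ `nonempty_unitHatSlice_iso_normalize`;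
  the Poincaré clause towards the renormalised pair by ★ `DualPair.nonempty_pullback_map_normalizeP_iso_of_hat_isBaseChangeVia`
  fed with `P₀.hatNormalised`.
* §3 `SiegelFineModuliScheme.smooth_of_forall_smallExtension_ne_top_exists_polarizedLift` — the `hF11` JUNCTION in the
  letter the producers (A4)/(A5) deliver: if along every genuine small extension `A ↠ A ⧸ J` (`J ≠ ⊤`, `𝔪_A J = 0`) of
  Artinian local `ℚ`-algebras every triple's POLARISED ABELIAN SCHEME lifts (level-free data as in §2), then
  `𝓜.M → Spec ℚ` is smooth — §2 (with `[N]_X` étale in characteristic `0`, ★ `etale_pow_id_left_of_charZero`, `N ≠ 0`) into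
  ★ edition 2 `smooth_of_forall_smallExtension_ne_top_exists_isBaseChangeVia`.

## References
* [MumfordFogartyKirwan1994] D. Mumford, J. Fogarty, F. Kirwan, *Geometric Invariant Theory*, 3rd ed. (1994), Ch. 6 §2
  (p. 121), Ch. 7 §2 Def. 7.1–7.2 (p. 129), Prop. 7.6 (p. 136), §3 Thm. 7.9 (p. 139), App. 7A (pp. 234–235).
* [SGA1] A. Grothendieck, *SGA 1* (LNM 224), Exp. I Cor. 5.6, Exp. III Thm. 3.1.
* [Lan2013PELCompactifications] K.-W. Lan, *Arithmetic compactifications of PEL-type Shimura varieties* (2013), §1.3.6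
  Lemma 1.3.6.6 (pp. 81–82), §2.2.1 (p. 130).
* [EGAIV4] A. Grothendieck, *EGA IV₄*, Prop. (17.14.2) (p. 98).
* [GortzWedhorn2023] U. Görtz, T. Wedhorn, *Algebraic Geometry II* (2023), Prop. 27.187 (`[N]` étale for `N` invertible).
-/

noncomputable section

universe u

open CategoryTheory CategoryTheory.Limits AlgebraicGeometry MonoidalCategory CartesianMonoidalCategory
open scoped MonObj

namespace Literature.AlgebraicGeometry.AbelianSchemes

namespace AbelianSchemeOver

variable {S : Scheme.{u}} (A : AbelianSchemeOver S)

/-! ## §1 Level structures lift along a base-change square over a surjective closed immersion (relation form) -/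

/-- **Level structures lift along a base-change square over a surjective closed immersion (relation form).**
Let `G : X₀ → X` over a surjective closed immersion `i : S₀ → S` exhibit the abelian scheme `A₀/S₀` as the base change
of `A/S` (★ `IsBaseChangeVia`), with `[N]_A` étale.  Then every level-`N` structure `φ₀` on `A₀` is the pull-back along
`(G, i)` of a level-`N` structure `φ` on `A`: the basis sections lift uniquely as `N`-torsion sections ([SGA1] I Cor. 5.6
on `[N]`, ★ `existsUnique_section_pow_eq_one_of_isBaseChangeVia`), and the basis clauses at a geometric point
`s = s₀ ≫ i` of `S` (every geometric point factors through `i`, ★ `exists_comp_eq_of_isClosedImmersion_of_surjective`)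
are those of `φ₀` at `s₀`, the `Ω`-points of the two fibres corresponding by the group isomorphism ★
`IsBaseChangeVia.pushHomMulEquiv` and Mumford's `σ^a` by ★ `IsBaseChangeVia.sectionPow_comp`.  (★
`LevelStructure.existsUnique_baseChange_eq` is the case `A₀ = A ×_S S₀`, `G = pr₁`.)
[cite: SGA1, Exp. I Cor. 5.6] [cite: MumfordFogartyKirwan1994, Ch. 7 §2 Definition 7.1 and Definition 7.2 (p. 129)] -/
theorem LevelStructure.exists_isBaseChangeVia_of_surjective {g₀ N : ℕ}
    [Etale ((((𝟙 A.X : A.X ⟶ A.X) ^ N) : A.X ⟶ A.X).left)]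
    {S₀ : Scheme.{u}} {i : S₀ ⟶ S} [IsClosedImmersion i] [Surjective i]
    {A₀ : AbelianSchemeOver S₀} {G : A₀.X.left ⟶ A.X.left} (hG : A₀.IsBaseChangeVia A i G)
    (φ₀ : A₀.LevelStructure g₀ N) :
    ∃ φ : A.LevelStructure g₀ N, φ₀.IsBaseChangeVia φ i G := by
  -- the unique `N`-torsion lifts of the basis sections
  have H : ∀ j, ∃! σ : A.Sections, σ ^ N = 1 ∧ (φ₀.σ j).left ≫ G = i ≫ σ.left := fun j =>
    A.existsUnique_section_pow_eq_one_of_isBaseChangeVia hG (φ₀.σ j) (φ₀.pow_σ j)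
  choose σ hσ _huniq using H
  have hpow : ∀ (a : Fin g₀ ⊕ Fin g₀ → ZMod N),
      (A₀.sectionPow φ₀.σ a).left ≫ G = i ≫ (A.sectionPow σ a).left := fun a =>
    hG.sectionPow_comp (fun k => (hσ k).2) a
  have hres : ∀ {Ω : Type u} [Field Ω] (s₀ : Spec (.of Ω) ⟶ S₀) (a : Fin g₀ ⊕ Fin g₀ → ZMod N),
      hG.pushHom (A₀.restrict s₀ (A₀.sectionPow φ₀.σ a)) = A.restrict (s₀ ≫ i) (A.sectionPow σ a) :=
    fun s₀ a => hG.pushHom_restrict s₀ (hpow a)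
  refine ⟨{ σ := σ
            pow_σ := fun j => (hσ j).1
            basis_injective := ?_
            basis_surjective := ?_ }, hG, fun j => (hσ j).2⟩
  · intro Ω _ _ s
    obtain ⟨s₀, rfl⟩ := exists_comp_eq_of_isClosedImmersion_of_surjective i s
    intro a b hab
    dsimp only at hab
    rw [← hres, ← hres] at hab
    exact φ₀.basis_injective s₀ ((hG.pushHomMulEquiv (Over.mk s₀)).injective hab)
  · intro Ω _ _ s
    obtain ⟨s₀, rfl⟩ := exists_comp_eq_of_isClosedImmersion_of_surjective i s
    intro x hx
    obtain ⟨y, hy'⟩ := (hG.pushHomMulEquiv (Over.mk s₀)).surjective x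
    have hy : y ^ N = 1 := (hG.pushHomMulEquiv (Over.mk s₀)).injective (by
      rw [map_pow, map_one]
      exact (congrArg (· ^ N) hy').trans hx)
    obtain ⟨a, ha⟩ := φ₀.basis_surjective s₀ y hy
    refine ⟨a, ?_⟩
    rw [← hres, ha]
    exact hy'

end AbelianSchemeOver

/-! ## §2 The row (A2): a level-free lift of a triple is a lift of the triple (after renormalising the dual pair) -/

namespace PolarizedAbelianSchemeWithLevel

open AbelianSchemeOver

variable {g N : ℕ} {δ : Fin g → ℕ}

/-- **(A2) A lift of the polarised abelian scheme of a moduli triple along a nilpotent thickening IS a lift of the triple.**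
Let `i : S₀ → S` be a surjective closed immersion (locally of finite type), `P₀ = (X₀, X̂₀, 𝒫₀, λ₀, σ₀)` a polarised abelian
scheme of type `δ` with symplectic-liftable level-`N` structure over `S₀` (★ `PolarizedAbelianSchemeWithLevel`, carrying its
second normalisation `hatNormalised`), and over `S`: an abelian scheme `X` of relative dimension `g` with `[N]_X` étale, a
dual pair `D = (X̂, 𝒫)`, a polarisation `pol = λ`, and morphisms `G : X₀ → X`, `Ĝ : X̂₀ → X̂` over `i` exhibiting `X₀`, `X̂₀` as
base changes of `X`, `X̂` as group schemes, with `(G ×_i Ĝ)^*𝒫 ≅ 𝒫₀` and `λ₀ ≫ Ĝ = G ≫ λ` (the four LEVEL-FREE clauses of ★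
`IsBaseChangeVia`).  Then there is a triple `P` over `S`, with underlying abelian scheme `X`, of which `P₀` is the pull-back along
`i` (`P₀.IsBaseChangeVia P i G Ĝ`, the same `G`, `Ĝ` — stated with `∃ G' Ĝ'` since `P` is bound) — namely `P = (X, D.normalize, λ, σ)` with: `σ` the unique lift of `σ₀` (§1, [SGA1] I Cor. 5.6); type `δ` and symplectic liftability
read off `P₀` at the geometric points of `S`, all of which factor through `i` (★ `Polarization.hasType_of_isBaseChangeVia`, ★
`LevelStructure.isSymplecticLiftable_of_isBaseChangeVia`; [Lan2013PELCompactifications] Lemma 1.3.6.6), unchanged by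
renormalisation (★ `Polarization.exists_normalize`, same `λ`); `hatNormalised` by ★ `DualPair.nonempty_unitHatSlice_iso_normalize`;
and the Poincaré clause `(G ×_i Ĝ)^*(𝒫 ⊗ (pr^*N_D)⁻¹) ≅ 𝒫₀` by ★ `DualPair.nonempty_pullback_map_normalizeP_iso_of_hat_isBaseChangeVia`,
since `𝒫₀` is normalised ([MumfordFogartyKirwan1994] Ch. 6 §2 p. 121).
[cite: MumfordFogartyKirwan1994, Ch. 7 §2 Definition 7.2 (p. 129) and Proposition 7.6 (p. 136)] [cite: SGA1, Exp. I Cor. 5.6]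
[cite: Lan2013PELCompactifications, §1.3.6 Lemma 1.3.6.6 (pp. 81–82) and §2.2.1 (p. 130)] [cite: MumfordFogartyKirwan1994, Ch. 6 §2 (p. 121)] -/
theorem exists_isBaseChangeVia_of_polarizedLift {S₀ S : Scheme.{u}} (i : S₀ ⟶ S) [IsClosedImmersion i] [Surjective i]
    (P₀ : PolarizedAbelianSchemeWithLevel g N δ S₀) (X : AbelianSchemeOver S)
    [Etale ((((𝟙 X.X : X.X ⟶ X.X) ^ N) : X.X ⟶ X.X).left)] (hX : X.IsOfRelDim g) (D : X.DualPair)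
    (pol : X.Polarization D) (G : P₀.A.X.left ⟶ X.X.left) (Ĝ : P₀.D.hat.X.left ⟶ D.hat.X.left)
    (hG : P₀.A.IsBaseChangeVia X i G) (hĜ : P₀.D.hat.IsBaseChangeVia D.hat i Ĝ)
    (hP : Nonempty ((Scheme.Modules.pullback
      (pullback.map P₀.A.X.hom P₀.D.hat.X.hom X.X.hom D.hat.X.hom G Ĝ i hG.fst.symm hĜ.fst.symm)).obj D.P ≅ P₀.D.P))
    (hlam : P₀.pol.lam.left ≫ Ĝ = G ≫ pol.lam.left) :
    ∃ (P : PolarizedAbelianSchemeWithLevel g N δ S) (G' : P₀.A.X.left ⟶ P.A.X.left)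
      (Ĝ' : P₀.D.hat.X.left ⟶ P.D.hat.X.left), P.A = X ∧ P₀.IsBaseChangeVia P i G' Ĝ' := by
  -- a closed immersion is finite, hence locally of finite type (geometric points of `S` lift along `i`)
  haveI : LocallyOfFiniteType i := inferInstance
  -- §1: the level structure lifts (relation form)
  obtain ⟨φ, hφ⟩ := LevelStructure.exists_isBaseChangeVia_of_surjective X hG P₀.level
  -- renormalise: a polarisation w.r.t. `D.normalize` with the same `λ`
  obtain ⟨pol', hpol'⟩ := pol.exists_normalize
  have hcomm : P₀.pol.lam.left ≫ Ĝ = G ≫ pol'.lam.left := by rw [hpol']; exact hlam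
  -- the Poincaré clause towards the renormalised pair, with `𝒫₀` itself (`P₀` is normalised)
  have hPc : Nonempty ((Scheme.Modules.pullback
      (pullback.map P₀.A.X.hom P₀.D.hat.X.hom X.X.hom D.hat.X.hom G Ĝ i hG.fst.symm hĜ.fst.symm)).obj D.normalizeP ≅
        P₀.D.P) :=
    DualPair.nonempty_pullback_map_normalizeP_iso_of_hat_isBaseChangeVia D P₀.D hĜ hG.fst.symm hP P₀.hatNormalised
  -- the dual pair of the lift IS `D.normalize` (`D.normalize.hat = D.hat`, `D.normalize.P = D.normalizeP`, both `rfl`)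
  have hĜ' : P₀.D.hat.IsBaseChangeVia D.normalize.hat i Ĝ := hĜ
  have hPc' : Nonempty ((Scheme.Modules.pullback
      (pullback.map P₀.A.X.hom P₀.D.hat.X.hom X.X.hom D.normalize.hat.X.hom G Ĝ i hG.fst.symm hĜ'.fst.symm)).obj
        D.normalize.P ≅ P₀.D.P) := hPc
  -- type `δ` and symplectic liftability, read at the geometric points of `S` (which factor through `i`)
  have hT : pol'.HasType δ :=
    Polarization.hasType_of_isBaseChangeVia hG P₀.D D.normalize hĜ' P₀.pol pol' hcomm P₀.hasType
  have hsymp : φ.IsSymplecticLiftable pol' δ :=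
    LevelStructure.isSymplecticLiftable_of_isBaseChangeVia hG P₀.D D.normalize hĜ' P₀.level φ hφ.2 P₀.pol pol' hcomm
      hPc' δ P₀.symplectic
  exact ⟨{ A := X
           relDim := hX
           D := D.normalize
           pol := pol'
           hasType := hT
           level := φ
           symplectic := hsymp
           hatNormalised := D.nonempty_unitHatSlice_iso_normalize }, G, Ĝ, rfl,
    hφ, hĜ', ⟨hG.fst.symm, hĜ'.fst.symm, hPc'⟩, hcomm⟩

end PolarizedAbelianSchemeWithLevel

end Literature.AlgebraicGeometry.AbelianSchemes

/-! ## §3 The `hF11` junction in the producers' letter: polarised lifts along genuine small extensions ⟹ `Smooth 𝓜.M.hom` -/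

namespace Literature.AlgebraicGeometry.ModuliOfAbelianVarieties

open Literature.AlgebraicGeometry.Motives (SchemeOver specOver)
open Literature.AlgebraicGeometry.AbelianSchemes

namespace SiegelFineModuliScheme

variable {g N : ℕ} {δ : Fin g → ℕ} (𝓜 : SiegelFineModuliScheme g N δ)

/-- **F-11 from the Artinian lifting of POLARISED ABELIAN SCHEMES** ([MumfordFogartyKirwan1994] Thm. 7.9 «smooth» /
[Lan2013PELCompactifications] §2.2.1; [EGAIV4] (17.14.2)).  Let `𝓜` be a fine moduli scheme of polarised abelian schemes of
type `δ` with symplectic level-`N` structure over `ℚ` (`N ≠ 0`), locally of finite type over `ℚ`.  Suppose that for every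
Artinian local `ℚ`-algebra `A`, every ideal `J ≠ ⊤` with `𝔪_A · J = 0` and every triple `P₀ = (X₀, X̂₀, 𝒫₀, λ₀, σ₀)` over
`Spec (A ⧸ J)` there are, over `Spec A`, an abelian scheme `X` of relative dimension `g`, a dual pair `(X̂, 𝒫)`, a
polarisation `λ` and morphisms `G : X₀ → X`, `Ĝ : X̂₀ → X̂` over `Spec (A ⧸ J) → Spec A` exhibiting `X₀`, `X̂₀` as base changes
of `X`, `X̂` as group schemes with `(G × Ĝ)^*𝒫 ≅ 𝒫₀` and `λ₀ ≫ Ĝ = G ≫ λ` (NO level structure, NO normalisation asked of the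
lift).  Then **`𝓜.M → Spec ℚ` is smooth**: §2 turns each such lift into a lift of the triple (`[N]_X` étale over the
`ℚ`-algebra `A`, ★ `etale_pow_id_left_of_charZero`), and ★ `smooth_of_forall_smallExtension_ne_top_exists_isBaseChangeVia`
(EGA IV 17.14.2 through «fine moduli») concludes.  Rows (A4) (abelian schemes are unobstructed) and (A5) (the polarisation
and the dual pair lift) of ROAD A prove exactly this hypothesis.
[cite: MumfordFogartyKirwan1994, Ch. 7 §3 Theorem 7.9 (p. 139)] [cite: Lan2013PELCompactifications, §2.2.1 (p. 130)]
[cite: EGAIV4, Prop. (17.14.2) p. 98] [cite: SGA1, Exp. I Cor. 5.6] -/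
theorem smooth_of_forall_smallExtension_ne_top_exists_polarizedLift [LocallyOfFiniteType 𝓜.M.hom] (hN : N ≠ 0)
    (H : ∀ (A : Type) [CommRing A] [Algebra ℚ A] [IsArtinianRing A] [IsLocalRing A] (J : Ideal A),
      J ≠ ⊤ → IsLocalRing.maximalIdeal A * J = ⊥ →
      ∀ P₀ : PolarizedAbelianSchemeWithLevel g N δ (Spec (.of (A ⧸ J))),
        ∃ (X : AbelianSchemeOver (Spec (.of A))) (_ : X.IsOfRelDim g) (D : X.DualPair) (pol : X.Polarization D)
          (G : P₀.A.X.left ⟶ X.X.left) (Ĝ : P₀.D.hat.X.left ⟶ D.hat.X.left)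
          (hG : P₀.A.IsBaseChangeVia X (Spec.map (CommRingCat.ofHom (Ideal.Quotient.mk J))) G)
          (hĜ : P₀.D.hat.IsBaseChangeVia D.hat (Spec.map (CommRingCat.ofHom (Ideal.Quotient.mk J))) Ĝ),
          Nonempty ((Scheme.Modules.pullback
            (pullback.map P₀.A.X.hom P₀.D.hat.X.hom X.X.hom D.hat.X.hom G Ĝ
              (Spec.map (CommRingCat.ofHom (Ideal.Quotient.mk J))) hG.fst.symm hĜ.fst.symm)).obj D.P ≅ P₀.D.P) ∧
          P₀.pol.lam.left ≫ Ĝ = G ≫ pol.lam.left) :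
    Smooth 𝓜.M.hom := by
  refine 𝓜.smooth_of_forall_smallExtension_ne_top_exists_isBaseChangeVia fun A _ _ _ _ J hJtop hJ P₀ => ?_
  obtain ⟨X, hX, D, pol, G, Ĝ, hG, hĜ, hP, hlam⟩ := H A J hJtop hJ P₀
  -- the thickening `Spec (A ⧸ J) → Spec A`: a surjective closed immersion (one point on each side)
  haveI : Nontrivial (A ⧸ J) := Ideal.Quotient.nontrivial_iff.mpr hJtop
  haveI : IsClosedImmersion (Spec.map (CommRingCat.ofHom (Ideal.Quotient.mk J))) :=
    IsClosedImmersion.spec_of_surjective _ Ideal.Quotient.mk_surjective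
  haveI : Surjective (Spec.map (CommRingCat.ofHom (Ideal.Quotient.mk J))) := ⟨by
    intro y
    obtain ⟨M, hM⟩ := Ideal.exists_maximal (A ⧸ J)
    refine ⟨(⟨M, hM.isPrime⟩ : PrimeSpectrum (A ⧸ J)), PrimeSpectrum.ext ?_⟩
    rw [IsLocalRing.eq_maximalIdeal (IsArtinianRing.isMaximal_of_isPrime y.asIdeal)]
    exact IsLocalRing.eq_maximalIdeal (IsArtinianRing.isMaximal_of_isPrime _)⟩
  -- `[N]_X` is étale over the `ℚ`-algebra `A` (characteristic `0`, `N ≠ 0`)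
  haveI := X.etale_pow_id_left_of_charZero (Spec.map (CommRingCat.ofHom (algebraMap ℚ A))) hN
  obtain ⟨P, G', Ĝ', -, hrel⟩ := PolarizedAbelianSchemeWithLevel.exists_isBaseChangeVia_of_polarizedLift
    (Spec.map (CommRingCat.ofHom (Ideal.Quotient.mk J))) P₀ X hX D pol G Ĝ hG hĜ hP hlam
  exact ⟨P, G', Ĝ', hrel⟩

end SiegelFineModuliScheme

end Literature.AlgebraicGeometry.ModuliOfAbelianVarieties

end
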